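import Literature.NumberTheory.Automorphic.UnitaryThreeAnisotropicNormalForm                   -- ★ (d1) `exists_smul_one_inv_mul_conj_mem_stabilizer` (t′ = z⁻¹(g⁻¹tg) ∈ Stab(w₀)), `map_mul_self_eq_one_of_mulVec_eq_smul`
import Literature.NumberTheory.Automorphic.UnitaryThreeAnisotropicNormalFormExponents          -- ★ (d2) `model_trace_det_of_normalForm`, `v_model_invariants_eq`, `v_sub_one_eq_of_lt`, `natCard_fixedPoints_quotient_normalForm_eq`
import Literature.NumberTheory.Automorphic.UnitaryThreeAnisotropicFixedPointSum               -- ★ (L6) `natCard_fixedPoints_unitaryInt_eq_phiTHprimeM` (Flicker Prop. 17, modulo `hβ`)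
import Literature.NumberTheory.Automorphic.UnitaryThreeAnisotropicFixedPointCountMid           -- ★ the regime-2 count `hβ` `natCard_fixedPoints_quotient_of_le_of_le`, `mem_stabilizer_anisoVec_iff`
import Literature.NumberTheory.Rogawski1990.UnitOrbitalIntegralInertClosedFormsTypeTwoObservable   -- ★ `phiTHprimen`, `phiTHprimen_eq_phiTHprimeM_of_eq_min`
import HarnessLib

/-!
# R90 · S6 — LINE G1 «geometric fixed subtree», RUNG 2 ODD EDITION, FILE A: THE FIXED HYPERSPECIAL COUNT OF A TYPE-(2) ELEMENT WITH ODD EIGENLINE —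
# `#Fix_t(U ⧸ U(𝒪)) = phiTHprimen q n N` (`Theorems/R90S6TorusFixedHyperspecialCountTypeTwoOdd.lean`)

Cell `hodgecm-mathlib`, crux H413 (`stmt-HodgeConjecture-24833`), route of record `HCCMUnconditional`; programme R90-TF, section S6 (base `R90-C14`), seat R90-C14-p07 (g2,
heir of g0); S6 dealer R90-C14-plan (g2) CARD (G2-ODD) «G1 RUNG 2 ODD EDITION» (2026-09-05T02:52:41Z) + GO FILE A (02:58:02Z, census 02:56:51Z «=»): the literal-free
`κ = −1` twin of ★ a₀ `natCard_fixedPoints_unitaryInt_eq_phiTHn_of_eigen` (`Literature/NumberTheory/Rogawski1990/UnitOrbitalIntegralInertValueTHEigen.lean`), in ★ a₀'s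
binders (`hJ, hd, hσO, q, hq, hq1, a₀, ha₀, t, x, u, htx, k, N, n, hN, hn` VERBATIM; of ★ a₀'s even frame the letters `y, c, um, R, ι, σR, dR, ϖR, hqR` and the finiteness binder
`hfin` are NOT needed by the odd chain and are dropped) with the ODD eigenline `hx : v (B₀ σ 3 x x) = exp (2k+1)`.  Helper lane `--supports stmt-HodgeConjecture-24833 --as
helper`; ONE theorem (no definition, no instance, no notation, no named fact, no `sorry`); imports = ★ (d1) + ★ (d2) + ★ (L6) + ★ `hβ` + ★ `phiTHprimen` + HarnessLib.

THE MATHEMATICS [Flicker1998UnitaryFL, Prop. 5 p. 82, Prop. 16 p. 96, Prop. 17 p. 97, Theorem 18 p. 97; Rogawski1990, §4.9 Prop. 4.9.1 (b) p. 55; Kottwitz1988, §2].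
`K` non-dyadic discretely valued, complete, residue field of order `q²`, `σ` the unramified involution (`hd : LocalConjDatum σ ϖ`), `U = U(σ, J₀)(K)`, `J₀ = Φ₃` antidiagonal,
`U(𝒪) = unitaryInt σ J₀` (stabiliser of the root hyperspecial vertex `L₀`).  A TYPE-(2) `t ∈ U` (anisotropic eigenvector `x`, `tx = ux`, quadratic factor `χ₂ = X² − TX + D`,
`T = tr t − u`, `D = det t ∕ u`, irreducible with RAMIFIED splitting field: `|T² − 4D| = |ϖ|^{2N+1}`, `|χ₂(u)| = |ϖ|^n`) whose eigenline is ODD (`|B₀(x,x)| = |ϖ|^{2k+1}`, i.e.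
`κ(t) = −1`, the second `G`-class in the stable class) has **`#Fix_t(U ⧸ U(𝒪)) = phiTHprimen q n N`** (Flicker's `Φ′(t″)`, THEOREM 18's `κ = −1` column).  PROOF = the abstract
`κ = −1` road of the tree, assembled here for the first time outside the CM pins (the CM-pinned assembly is `Rogawski1990/UnitOrbitalIntegralInertValueTHprimeClosed.lean`
§3–§8; a COUNT needs neither its compactness transport nor its orbital-integral socket): (d1) `t′ = z⁻¹(g⁻¹tg) ∈ Stab(w₀)`, `w₀ = (1,0,−2ϖ)`, `z = u·1 ∈ U(𝒪)` central, with
coordinates `t′ = (1+2ϖb, q, b; 2ϖr, s, r; 4ϖ²b, 2ϖq, 1+2ϖb)`; (d2) the model data `A + s = T∕u`, `As − 4ϖqr = D∕u²` (`A = 1+4ϖb`) and `|disc| = |T² − 4D|`, `|A+s−2| = |T−2u|`,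
`|χ_model(1)| = |χ₂(u)|`; the sizes `|q| = |r| = |ϖ|^N`, `|A − s| ≤ |ϖ|^{N+1}` from the odd discriminant; the `M`-datum `|A − 1|` vs `|ϖ|^M` and the EXPONENT LAW
`n = min(2N+1, 2M)` (`4χ₂(u) = (T−2u)² − (T²−4D)`, orders of different parity never cancel; `M := N+1` when `T = 2u`); (L6) `#Fix_{t′}(U ⧸ U(𝒪)) = phiTHprimeM q M N` with the
regime-2 count `hβ`; conjugation∕central invariance `#Fix_{t′} = #Fix_t`; `phiTHprimen q n N = phiTHprimeM q M N` under the law.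
HONEST LABEL: an assembly of ★ abstract lemmas, unconditional in its own letters; count-neutral until the E1.3.5.2 (E2) assembly reads it at the pins; proves no printed
statement by itself.  HC_CM is proved only modulo the 7 printed citations (2 remaining named inputs: hLiu418 = stmt-HodgeConjecture-24832, h413 = stmt-HodgeConjecture-24833)
until rung 0 closes.

## References
* [Flicker1998UnitaryFL] Y. Z. Flicker, *Elementary proof of the fundamental lemma for a unitary group*, Canad. J. Math. 50 (1998), Prop. 5 p. 82; Prop. 16 p. 96;
  Prop. 17 p. 97; Theorem 18 p. 97.
* [Rogawski1990] J. D. Rogawski, *Automorphic Representations of Unitary Groups in Three Variables*, Ann. of Math. Stud. 123 (1990), §4.9 Prop. 4.9.1 (b) p. 55.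
* [Kottwitz1988] R. E. Kottwitz, *Tamagawa numbers*, Ann. of Math. 127 (1988), §2 (fixed-point counts on buildings).
-/
set_option autoImplicit false
-- the mandated namespace repeats the single-problem summit's segment (`HodgeConjecture.HodgeConjecture`)
set_option linter.dupNamespace false

noncomputable section

open Literature.NumberTheory.Automorphic Literature.NumberTheory.Automorphic.HermitianLattice Literature.NumberTheory.Automorphic.UnitaryGroup
open Literature.NumberTheory.Rogawski1990.Flicker1998 (phiTHprimen phiTHprimeM phiTHprimen_eq_phiTHprimeM_of_eq_min)
open IsLocalRing
open scoped Matrix MatrixGroups WithZero Valued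

namespace Summit.HodgeConjecture.HodgeConjecture.R90.S6

/-- **G1 RUNG 2 ODD EDITION, FILE A — `#Fix_t(U ⧸ U(𝒪)) = phiTHprimen q n N` FOR A TYPE-(2) `t` WITH ODD EIGENLINE** (`κ(t) = −1`): in ★ a₀'s letters (`tx = ux`,
`|T² − 4D| = |ϖ^{2N+1}|`, `|χ₂(u)| = |ϖ^n|`, `T = tr t − u`, `D = det t ∕ u`; frame `hd, hσO, a₀, q`) with `|B₀(x,x)| = exp(2k+1)`, the number of `t`-fixed hyperspecial
vertices `#{z ∈ U ⧸ unitaryInt σ J₀ : t·z = z}` is Flicker's `Φ′ = phiTHprimen q n N`.  Assembly of ★ (d1) normal form in `Stab(w₀)` → ★ (d2) model data and exponents →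
sizes `|q| = |r| = |ϖ|^N`, `|A − s| ≤ |ϖ|^{N+1}` → `M`-datum and exponent law `n = min(2N+1, 2M)` → ★ (L6) + ★ `hβ` → central∕conjugation invariance → ★
`phiTHprimen_eq_phiTHprimeM_of_eq_min`. [cite: Flicker1998UnitaryFL, Prop. 17 p. 97; Theorem 18 p. 97] [cite: Rogawski1990, §4.9 Prop. 4.9.1 (b) p. 55] [cite: Kottwitz1988, §2] -/
theorem natCard_fixedPoints_unitaryInt_eq_phiTHprimen_of_eigen_odd {K : Type*} [Field K] [Valued K ℤᵐ⁰] {ϖ : K} (σ : K →+* K)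
    {J : Matrix (Fin 3) (Fin 3) K} (hJ : J = (StdForm.antidiagonal 3).over K) (hd : LocalConjDatum σ ϖ)
    (hσO : ∀ y : 𝒪[K], (σ.comp 𝒪[K].subtype) y ∈ 𝒪[K])
    [IsDiscreteValuationRing 𝒪[K]] [Finite (ResidueField 𝒪[K])] [IsAdicComplete (maximalIdeal 𝒪[K]) 𝒪[K]]
    {q : ℕ} (hq : Nat.card (ResidueField 𝒪[K]) = q ^ 2) (hq1 : 1 < q)
    {a₀ : 𝒪[K]} (ha₀ : IsUnit (((σ.comp 𝒪[K].subtype).codRestrict 𝒪[K] hσO) a₀ - a₀))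
    {t : ↥(unitaryGroupOfForm σ J)} {x : Fin 3 → K} {u : K} (htx : (((t : ↥(unitaryGroupOfForm σ J)) : GL (Fin 3) K) : Matrix (Fin 3) (Fin 3) K) *ᵥ x = u • x) {k : ℤ}
    (hx : Valued.v (B₀ σ 3 x x) = WithZero.exp (2 * k + 1))
    {N n : ℕ} (hN : Valued.v ((Matrix.trace (((t : ↥(unitaryGroupOfForm σ J)) : GL (Fin 3) K) : Matrix (Fin 3) (Fin 3) K) - u) ^ 2 -
      4 * (Matrix.det (((t : ↥(unitaryGroupOfForm σ J)) : GL (Fin 3) K) : Matrix (Fin 3) (Fin 3) K) / u)) = Valued.v (ϖ ^ (2 * N + 1)))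
    (hn : Valued.v (u ^ 2 - (Matrix.trace (((t : ↥(unitaryGroupOfForm σ J)) : GL (Fin 3) K) : Matrix (Fin 3) (Fin 3) K) - u) * u +
      Matrix.det (((t : ↥(unitaryGroupOfForm σ J)) : GL (Fin 3) K) : Matrix (Fin 3) (Fin 3) K) / u) = Valued.v (ϖ ^ n)) :
    (Nat.card {z : ↥(unitaryGroupOfForm σ J) ⧸ unitaryInt σ J | t • z = z} : ℚ) = phiTHprimen q n N := by
  -- §0 the letters `T = tr t − u`, `D = det t ∕ u`; `|ϖ^m| = exp(−m)`, `|4| = 1`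
  set T : K := Matrix.trace (((t : ↥(unitaryGroupOfForm σ J)) : GL (Fin 3) K) : Matrix (Fin 3) (Fin 3) K) - u with hT
  set D : K := Matrix.det (((t : ↥(unitaryGroupOfForm σ J)) : GL (Fin 3) K) : Matrix (Fin 3) (Fin 3) K) / u with hD
  have hvpow : ∀ m : ℕ, Valued.v (ϖ ^ m) = WithZero.exp (-(m : ℤ)) := fun m => by
    rw [map_pow, hd.vϖ, ← WithZero.exp_nsmul, nsmul_eq_mul, mul_neg, mul_one]
  have h4 : Valued.v (4 : K) = 1 := by
    rw [show (4 : K) = 2 * 2 by norm_num, map_mul, hd.v2, one_mul]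
  have hNexp : Valued.v (T ^ 2 - 4 * D) = WithZero.exp (-((2 * N + 1 : ℕ) : ℤ)) := by rw [hN, hvpow]
  have hnexp : Valued.v (u ^ 2 - T * u + D) = WithZero.exp (-(n : ℤ)) := by rw [hn, hvpow]
  -- §1 the κ = −1 normal form `t′ = z⁻¹ (g⁻¹ t g) ∈ Stab(w₀)` (★ (d1)) and its coordinates
  have hB0 : B₀ σ 3 x x ≠ 0 := fun h0 => by
    rw [h0, map_zero] at hx
    exact WithZero.coe_ne_zero hx.symm
  obtain ⟨g, z, hz, hzK, hzc, -, ht'S⟩ := exists_smul_one_inv_mul_conj_mem_stabilizer σ hJ hd hσO ha₀ htx hx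
  obtain ⟨bt, qt, rt, st, ht'c⟩ := exists_coe_eq_of_mulVec_anisoVec_eq σ hJ hd ((mem_stabilizer_anisoVec_iff σ _ _).1 ht'S)
  -- §2 model data (★ (d2)): `A + s = T ∕ u`, `As − 4ϖqr = D ∕ u²`; valuations of disc, `A + s − 2`, `χ_model(1)`
  have hu1 : σ u * u = 1 := map_mul_self_eq_one_of_mulVec_eq_smul σ hJ t htx hB0
  have hu0 : u ≠ 0 := fun h0 => by rw [h0, mul_zero] at hu1; exact zero_ne_one hu1
  have htr : Matrix.trace (((t : ↥(unitaryGroupOfForm σ J)) : GL (Fin 3) K) : Matrix (Fin 3) (Fin 3) K) = T + u := by rw [hT]; ring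
  have hdet : Matrix.det (((t : ↥(unitaryGroupOfForm σ J)) : GL (Fin 3) K) : Matrix (Fin 3) (Fin 3) K) = D * u := by
    rw [hD]; exact (div_mul_cancel₀ _ hu0).symm
  obtain ⟨hAs, hdet2⟩ := model_trace_det_of_normalForm σ hu0 hz htr hdet ht'c
  obtain ⟨hvdisc, hvtr, hveval⟩ := v_model_invariants_eq σ hJ hd ht'c hu1 hAs hdet2
  -- §3 the type-(2) sizes `|q_t| = |r_t| = |ϖ|^N`, `|A_t − s_t| ≤ |ϖ|^{N+1}` from the odd discriminant
  obtain ⟨hst1, -, hAt1, -⟩ := stabilizer_valuation_bounds σ hJ hd ht'c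
  have hDv : Valued.v (((1 + 4 * ϖ * bt) - st) ^ 2 - 16 * ϖ * (1 + 4 * ϖ * bt) * (σ qt * qt) / σ st) = WithZero.exp (-((2 * N + 1 : ℕ) : ℤ)) := by
    rw [hvdisc]; exact hNexp
  obtain ⟨hqt, hAst⟩ := v_q_eq_and_v_sub_le_of_v_disc σ hd hAt1 hst1 N hDv
  have hrt : Valued.v rt = WithZero.exp (-(N : ℤ)) := by
    rw [stabilizer_v_r_eq_v_q σ hJ hd ht'c, hqt]
  -- §4 the `M`-datum and the exponent law `n = min(2N+1, 2M)`: `4·χ₂(u) = (T − 2u)² − (T² − 4D)`, parities never cancel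
  obtain ⟨M, hMle, hMgt, hlaw⟩ : ∃ M : ℕ,
      (M ≤ N → Valued.v ((1 + 4 * ϖ * bt) - 1) = WithZero.exp (-(M : ℤ))) ∧
      (N < M → Valued.v ((1 + 4 * ϖ * bt) - 1) ≤ WithZero.exp (-((N : ℤ) + 1))) ∧
      n = min (2 * N + 1) (2 * M) := by
    by_cases htb : T = 2 * u
    · -- `T = 2u` (`M = ∞`, capped at `N + 1`): `|χ₂(u)| = |T² − 4D|`, `n = 2N + 1`
      refine ⟨N + 1, fun hMN => absurd hMN (by omega), fun _ => ?_, ?_⟩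
      · refine v_sub_one_le_of_le σ hd hAst ?_
        rw [hvtr, htb, sub_self, map_zero]; exact zero_le
      · have key : (4 : K) * (u ^ 2 - T * u + D) = -(T ^ 2 - 4 * D) := by rw [htb]; ring
        have hval : Valued.v (u ^ 2 - T * u + D) = Valued.v (T ^ 2 - 4 * D) := by
          rw [← Valuation.map_neg _ (T ^ 2 - 4 * D), ← key, map_mul, h4, one_mul]
        rw [hnexp, hNexp] at hval
        have h2 := WithZero.exp_injective hval
        rw [min_eq_left (by omega)]; omega
    · -- `T ≠ 2u`: `M := ord(T − 2u) = ord(A + s − 2)`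
      have hne : T - 2 * u ≠ 0 := sub_ne_zero.2 htb
      have hle : Valued.v (T - 2 * u) ≤ 1 := by
        rw [← hvtr]
        refine (Valuation.map_sub _ _ _).trans (max_le ((Valuation.map_add _ _ _).trans (max_le hAt1.le hst1.le)) ?_)
        rw [hd.v2]
      obtain ⟨M, hM⟩ : ∃ M : ℕ, Valued.v (T - 2 * u) = WithZero.exp (-(M : ℤ)) := by
        have hv0 : Valued.v (T - 2 * u) ≠ 0 := (Valuation.ne_zero_iff _).2 hne
        have hlog : WithZero.log (Valued.v (T - 2 * u)) ≤ 0 := by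
          rw [WithZero.log_le_iff_le_exp hv0, WithZero.exp_zero]
          exact hle
        refine ⟨(-WithZero.log (Valued.v (T - 2 * u))).toNat, ?_⟩
        rw [Int.toNat_of_nonneg (by omega), neg_neg, WithZero.exp_log hv0]
      refine ⟨M, fun hMN => ?_, fun hNM => ?_, ?_⟩
      · rw [← hM, ← hvtr]
        refine v_sub_one_eq_of_lt σ hd hAst ?_
        rw [hvtr, hM, WithZero.exp_lt_exp]; omega
      · refine v_sub_one_le_of_le σ hd hAst ?_
        rw [hvtr, hM, WithZero.exp_le_exp]; omega
      · have key : (4 : K) * (u ^ 2 - T * u + D) = (T - 2 * u) ^ 2 - (T ^ 2 - 4 * D) := by ring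
        have hsq : Valued.v ((T - 2 * u) ^ 2) = WithZero.exp (-(2 * (M : ℤ))) := by
          rw [map_pow, hM, pow_two, ← WithZero.exp_add]
          congr 1; ring
        have hval : Valued.v (u ^ 2 - T * u + D) = Valued.v ((T - 2 * u) ^ 2 - (T ^ 2 - 4 * D)) := by
          rw [← key, map_mul, h4, one_mul]
        rw [hnexp] at hval
        rcases Nat.lt_or_ge (2 * M) (2 * N + 1) with hlt | hge
        · -- the square dominates: `n = 2M`
          have h : Valued.v (T ^ 2 - 4 * D) < Valued.v ((T - 2 * u) ^ 2) := by
            rw [hsq, hNexp, WithZero.exp_lt_exp]; push_cast; omega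
          rw [Valuation.map_sub_eq_of_lt_left _ h, hsq] at hval
          have h2 := WithZero.exp_injective hval
          rw [min_eq_right hlt.le]; omega
        · -- the discriminant dominates (`2N + 1 < 2M` by parity): `n = 2N + 1`
          have hlt : 2 * N + 1 < 2 * M := lt_of_le_of_ne hge (by omega)
          have h : Valued.v ((T - 2 * u) ^ 2) < Valued.v (T ^ 2 - 4 * D) := by
            rw [hsq, hNexp, WithZero.exp_lt_exp]; push_cast; omega
          rw [Valuation.map_sub_eq_of_lt_right _ h, hNexp] at hval
          have h2 := WithZero.exp_injective hval
          rw [min_eq_left hlt.le]; omega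
  -- §5 the count (★ (L6) with ★ `hβ`): `#Fix(t′) = phiTHprimeM q M N`; `#Fix(t) = #Fix(t′)`; `phiTHprimen q n N = phiTHprimeM q M N`
  have hd3 : ∀ m : ℕ, ∃ d : ↥(unitaryGroupOfForm σ J),
      ((d : GL (Fin 3) K) : Matrix (Fin 3) (Fin 3) K) = !![ϖ ^ m, 0, 0; 0, 1, 0; 0, 0, (ϖ ^ m)⁻¹] :=
    fun m => exists_coe_eq_flickerDiag σ hJ hd m
  choose d hdm using hd3
  have hcount := natCard_fixedPoints_unitaryInt_eq_phiTHprimeM σ hJ hd hσO ha₀ hq hq1 d hdm ht'S ht'c N M hqt hAst hMle hMgt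
    (fun m h1 h2 h3 => natCard_fixedPoints_quotient_of_le_of_le σ hJ hd hσO ha₀ hq d m (hdm m) ht'S ht'c N h1.le h2 hqt hrt hAst (hMgt h3))
  have hfix := (natCard_fixedPoints_quotient_normalForm_eq σ (unitaryInt σ J) hzK hzc g t).1
  rw [← hfix, hcount, phiTHprimen_eq_phiTHprimeM_of_eq_min hlaw]

end Summit.HodgeConjecture.HodgeConjecture.R90.S6

end
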